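import Summits.CriticalPhenomena.PercolationContinuityZ3.Theorems.PercNearOneGluingNoHeavyLowerTailSahiThreeCopyTwoPoint
import Summits.CriticalPhenomena.PercolationContinuityZ3.Theorems.PercNearOneGluingNoHeavyLowerTailSahiThreeCopyBernstein
import Mathlib.Algebra.BigOperators.Fin

/-!
# `NoHeavyLowerTail` (crux stmt-CriticalPhenomena-4575), Sahi programme: **TWO-POINT CERTIFICATES, COMPUTED** — the sandwich check on
# binary-coded levels, the GENTOK certificate, and ★★ 3C-SAHI for EVERY triple whose first function depends on at most three (front)
# coordinates, the other two functions ARBITRARY nonnegative monotone on a cube of ANY dimension, at EVERY profile; law level: Kahn's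
# inequality `E₃ ≥ 0` under every product measure for this class

Support file (Sahi cell, seat `prim-sahi-p1`, generation 59; `--supports stmt-CriticalPhenomena-4575`); companion of `…SahiThreeCopyTwoPoint`
(the reduction theorem `tc_frontFn_nonneg_of_upSets`).  COMPUTATIONAL: one `native_decide` (`checkAll3_true`: the finite certificate check on
`{0,1}^3` for all 20 up-sets `f` and all 64 front profiles `π ∈ {0,1,2,3}^3`, exact rational arithmetic on binary-coded levels); everything
else is bookkeeping (coding levels by `finFunctionFinEquiv`, casting the rational check to the real forms (N1), (N2)).  The certificate is
the GENTOK rule of memo gen59 §4 (debt token `(e₁,e₂)` routed to the minimal elements of `⋃_{a ∈ min f, a ≤ e₁} f ∩ [e₂, e₂ ∨ a]`, equal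
split) — but NOTHING about the rule is proved or needed: it is DATA fed to a checker whose acceptance implies the hypotheses of the reduction
theorem.  New beyond the literal-peeling classes (`…PairsClosureLiterals`): e.g. `f = MAJ₃(x₀,x₁,x₂)` with `G, H` arbitrary.  Nothing
conjectural is used. [this work]
-/

namespace Summit.CriticalPhenomena.PercolationContinuityZ3.Theorems.SahiThreeCopy

open Finset Function Literature.Combinatorics.Sahi2008
open scoped BigOperators

/-! ### §1 Binary codes of levels and the computable checker -/

section Codes

variable {k : ℕ}

/-- Levels `{0,1}^k` ≃ codes `Fin (2^k)` (binary expansion, coordinate `i` has weight `2^i`). [this work] -/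
def codeE (k : ℕ) : Pt k ≃ Fin (2 ^ k) :=
  (Equiv.arrowCongr (Equiv.refl (Fin k)) finTwoEquiv.symm).trans finFunctionFinEquiv

/-- Bit `i` of a code. [this work] -/
def bitC (x : Fin (2 ^ k)) (i : Fin k) : ℕ := ((finFunctionFinEquiv.symm x) i : ℕ)

/-- Bits of the code are the coordinates. [this work] -/
theorem bitC_codeE (e : Pt k) (i : Fin k) : bitC (codeE k e) i = (e i).toNat := by
  unfold bitC codeE
  simp only [Equiv.trans_apply, Equiv.symm_apply_apply, Equiv.arrowCongr_apply, Equiv.refl_symm, Equiv.coe_refl,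
    Function.comp_apply, id_eq]
  cases e i <;> rfl

/-- Coded arrangement condition. [this work] -/
def IsArrC (π : Fin k → ℕ) (x y z : Fin (2 ^ k)) : Prop := ∀ i, bitC x i + bitC y i + bitC z i = π i

/-- `IsArrC` is decidable. [this work] -/
instance instDecidableIsArrC (π : Fin k → ℕ) (x y z : Fin (2 ^ k)) : Decidable (IsArrC π x y z) := by
  unfold IsArrC; infer_instance

/-- Arrangements ↔ coded arrangements. [this work] -/
theorem isArr_iff_isArrC (π : Fin k → ℕ) (x y z : Pt k) : IsArr π x y z ↔ IsArrC π (codeE k x) (codeE k y) (codeE k z) := by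
  unfold IsArr IsArrC; simp only [bitC_codeE]

/-- Coded coordinatewise order. [this work] -/
def LeC (x y : Fin (2 ^ k)) : Prop := ∀ i, bitC x i ≤ bitC y i

/-- `LeC` is decidable. [this work] -/
instance instDecidableLeC (x y : Fin (2 ^ k)) : Decidable (LeC x y) := by unfold LeC; infer_instance

/-- Order ↔ coded order. [this work] -/
theorem le_iff_leC (x y : Pt k) : x ≤ y ↔ LeC (codeE k x) (codeE k y) := by
  unfold LeC; simp only [bitC_codeE]
  constructor
  · intro h i; have := h i; revert this; cases x i <;> cases y i <;> simp
  · intro h i; have := h i; revert this; cases x i <;> cases y i <;> simp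

/-- Up-closed families of codes. [this work] -/
def UpClosedC (V : Finset (Fin (2 ^ k))) : Prop := ∀ x ∈ V, ∀ y : Fin (2 ^ k), LeC x y → y ∈ V

/-- `UpClosedC` is decidable. [this work] -/
instance instDecidableUpClosedC (V : Finset (Fin (2 ^ k))) : Decidable (UpClosedC V) := by
  unfold UpClosedC; infer_instance

/-- All up-closed families of codes. [this work] -/
def upSetsC (k : ℕ) : Finset (Finset (Fin (2 ^ k))) := univ.filter fun V => UpClosedC V

/-- The code image of an up-set is an up-closed family of codes. [this work] -/
theorem map_mem_upSetsC {V : Finset (Pt k)} (hV : IsUpperSet (V : Set (Pt k))) : V.map (codeE k).toEmbedding ∈ upSetsC k := by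
  simp only [upSetsC, mem_filter, mem_univ, true_and]
  intro x hx y hxy
  rw [mem_map_equiv] at hx ⊢
  refine hV ?_ hx
  rw [le_iff_leC]; simpa using hxy

/-- Arrangements of `π`, coded. [this work] -/
def arrSetC (π : Fin k → ℕ) : Finset (Fin (2 ^ k) × Fin (2 ^ k) × Fin (2 ^ k)) := univ.filter fun σ => IsArrC π σ.1 σ.2.1 σ.2.2

/-- Minimal elements (coded). [this work] -/
def minimalsC (S : Finset (Fin (2 ^ k))) : Finset (Fin (2 ^ k)) := S.filter fun x => ∀ y ∈ S, LeC y x → y = x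

/-- Coordinatewise join (coded; as data). [this work] -/
def ljoinC (x y : Fin (2 ^ k)) : Fin (2 ^ k) := Fin.ofNat (2 ^ k) (∑ i : Fin k, max (bitC x i) (bitC y i) * 2 ^ (i : ℕ))

/-- GENTOK targets of the debt token `(e₁,e₂)` (coded; as data). [this work] -/
def targetsC (F : Finset (Fin (2 ^ k))) (e₁ e₂ : Fin (2 ^ k)) : Finset (Fin (2 ^ k)) :=
  minimalsC (F.filter fun x => LeC e₂ x ∧ ∃ a ∈ minimalsC F, LeC a e₁ ∧ LeC x (ljoinC e₂ a))

/-- The GENTOK conversion table `e ↦ conv_e / mult(e)` (coded; DATA only — no property of it is proved). [this work] -/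
def thetaTabC (π : Fin k → ℕ) (F : Finset (Fin (2 ^ k))) : Array ℚ :=
  let A := arrSetC π
  ((List.finRange (2 ^ k)).map fun e =>
    if e ∈ F then
      let mult : ℚ := (A.filter fun σ => σ.1 = e).card
      let debt : ℚ := (A.filter fun σ => σ.2.1 = e ∧ σ.1 ∈ F).card
      let inflow : ℚ := ∑ σ ∈ A, if σ.1 ∈ F ∧ σ.2.1 ∉ F ∧ e ∈ targetsC F σ.1 σ.2.1 then (1 : ℚ) / (targetsC F σ.1 σ.2.1).card else 0
      (2 * mult - debt - inflow) / mult
    else 0).toArray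

/-- Per-arrangement weights read off a table by the first block's code. [this work] -/
def thetaC (tab : Array ℚ) (x : Fin (2 ^ k)) : ℚ := tab.getD (x : ℕ) 0

/-- Rational indicator of membership. [this work] -/
def mC (V : Finset (Fin (2 ^ k))) (x : Fin (2 ^ k)) : ℚ := if x ∈ V then 1 else 0

/-- (N1) on indicators, coded: `Σ_arr [(2f(e₁)−θ)V(e₁)W(e₁) − f(e₁)V(e₂)W(e₂)]`. [this work] -/
def N1C (A : Finset (Fin (2 ^ k) × Fin (2 ^ k) × Fin (2 ^ k))) (F : Finset (Fin (2 ^ k))) (tab : Array ℚ) (V W : Finset (Fin (2 ^ k))) : ℚ :=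
  ∑ σ ∈ A, ((2 * mC F σ.1 - thetaC tab σ.1) * (mC V σ.1 * mC W σ.1) - mC F σ.1 * (mC V σ.2.1 * mC W σ.2.1))

/-- (N2) on indicators, coded: `Σ_arr [θV(e₁)W(e₁) + f(e₁)V(e₂)W(e₃) − f(e₂)V(e₁)W(e₂) − f(e₂)V(e₂)W(e₁)]`. [this work] -/
def N2C (A : Finset (Fin (2 ^ k) × Fin (2 ^ k) × Fin (2 ^ k))) (F : Finset (Fin (2 ^ k))) (tab : Array ℚ) (V W : Finset (Fin (2 ^ k))) : ℚ :=
  ∑ σ ∈ A, (thetaC tab σ.1 * (mC V σ.1 * mC W σ.1) + mC F σ.1 * (mC V σ.2.1 * mC W σ.2.2)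
    - mC F σ.2.1 * (mC V σ.1 * mC W σ.2.1) - mC F σ.2.1 * (mC V σ.2.1 * mC W σ.1))

/-- The finite certificate check: `θ ≥ 0` and (N1), (N2) `≥ 0` on all pairs from `U`. [this work] -/
def certOKC (A : Finset (Fin (2 ^ k) × Fin (2 ^ k) × Fin (2 ^ k))) (U : Finset (Finset (Fin (2 ^ k)))) (F : Finset (Fin (2 ^ k)))
    (tab : Array ℚ) : Bool :=
  decide (∀ x : Fin (2 ^ k), 0 ≤ thetaC tab x) && decide (∀ V ∈ U, ∀ W ∈ U, 0 ≤ N1C A F tab V W ∧ 0 ≤ N2C A F tab V W)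

/-- The whole check at `k = 3`: all up-sets `f`, all front profiles `π ∈ {0,1,2,3}^3`. [this work] -/
def checkAll3 : Bool :=
  let U := upSetsC 3
  decide (∀ π : Fin 3 → Fin 4, ∀ F ∈ U, certOKC (arrSetC fun i => (π i : ℕ)) U F (thetaTabC (fun i => (π i : ℕ)) F) = true)

/-- ★ The GENTOK certificate passes the sandwich check on `{0,1}^3` for every up-set and every front profile (`20 × 64` cases, exact
rational arithmetic). [this work] -/
theorem checkAll3_true : checkAll3 = true := by
  native_decide

/-- Unpacked form of `checkAll3_true`. [this work] -/
theorem certOKC_three (π : Fin 3 → Fin 4) {F : Finset (Fin (2 ^ 3))} (hF : F ∈ upSetsC 3) :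
    certOKC (arrSetC fun i => (π i : ℕ)) (upSetsC 3) F (thetaTabC (fun i => (π i : ℕ)) F) = true := by
  have h := checkAll3_true
  unfold checkAll3 at h
  simp only [decide_eq_true_eq] at h
  exact h π F hF

end Codes

/-! ### §2 From the coded Boolean check to the hypotheses of the reduction theorem -/

section Bridge

variable {k : ℕ}

/-- Membership indicator under the coding. [this work] -/
theorem setInd_symm_codeE (V : Finset (Pt k)) (x : Fin (2 ^ k)) :
    setInd V ((codeE k).symm x) = ((mC (V.map (codeE k).toEmbedding) x : ℚ) : ℝ) := by
  unfold setInd mC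
  by_cases h : (codeE k).symm x ∈ V
  · have h' : x ∈ V.map (codeE k).toEmbedding := (mem_map_equiv (f := codeE k)).2 h
    rw [if_pos h, if_pos h']; simp
  · have h' : x ∉ V.map (codeE k).toEmbedding := fun hx => h ((mem_map_equiv (f := codeE k)).1 hx)
    rw [if_neg h, if_neg h']; simp

/-- Arrangement indicator under the coding. [this work] -/
theorem arrInd_symm_codeE (π : Fin k → ℕ) (x y z : Fin (2 ^ k)) :
    arrInd π ((codeE k).symm x) ((codeE k).symm y) ((codeE k).symm z) = if IsArrC π x y z then 1 else 0 := by
  unfold arrInd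
  simp only [isArr_iff_isArrC, Equiv.apply_symm_apply]

/-- A sum over all triples of levels is a sum over all triples of codes. [this work] -/
theorem sum_triple_codeE (g : Pt k × Pt k × Pt k → ℝ) :
    ∑ σ : Pt k × Pt k × Pt k, g σ =
      ∑ τ : Fin (2 ^ k) × Fin (2 ^ k) × Fin (2 ^ k), g ((codeE k).symm τ.1, (codeE k).symm τ.2.1, (codeE k).symm τ.2.2) := by
  let E : (Pt k × Pt k × Pt k) ≃ (Fin (2 ^ k) × Fin (2 ^ k) × Fin (2 ^ k)) :=
    (codeE k).prodCongr ((codeE k).prodCongr (codeE k))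
  rw [← Equiv.sum_comp E.symm]
  rfl

/-- A sum over the coded arrangement set, as an `if`-sum over all coded triples. [this work] -/
theorem cast_sum_arrSetC (π : Fin k → ℕ) (g : Fin (2 ^ k) × Fin (2 ^ k) × Fin (2 ^ k) → ℚ) :
    (((∑ σ ∈ arrSetC π, g σ : ℚ)) : ℝ) = ∑ τ : Fin (2 ^ k) × Fin (2 ^ k) × Fin (2 ^ k), if IsArrC π τ.1 τ.2.1 τ.2.2 then (g τ : ℝ) else 0 := by
  unfold arrSetC
  rw [Finset.sum_filter]
  push_cast
  refine sum_congr rfl fun τ _ => ?_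
  split_ifs <;> simp

/-- Bridge for (N1). [this work] -/
theorem N1form_eq_N1C (π : Fin k → ℕ) (A V W : Finset (Pt k)) (tab : Array ℚ) :
    N1form k π (setInd A) (fun a _ _ => (thetaC tab (codeE k a) : ℝ)) (setInd V) (setInd W) =
      ((N1C (arrSetC π) (A.map (codeE k).toEmbedding) tab (V.map (codeE k).toEmbedding) (W.map (codeE k).toEmbedding) : ℚ) : ℝ) := by
  unfold N1form N1C
  rw [sum_triple_codeE, cast_sum_arrSetC]
  refine sum_congr rfl fun τ _ => ?_
  simp only [arrInd_symm_codeE, setInd_symm_codeE, Equiv.apply_symm_apply]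
  split_ifs
  · push_cast; ring
  · simp

/-- Bridge for (N2). [this work] -/
theorem N2form_eq_N2C (π : Fin k → ℕ) (A V W : Finset (Pt k)) (tab : Array ℚ) :
    N2form k π (setInd A) (fun a _ _ => (thetaC tab (codeE k a) : ℝ)) (setInd V) (setInd W) =
      ((N2C (arrSetC π) (A.map (codeE k).toEmbedding) tab (V.map (codeE k).toEmbedding) (W.map (codeE k).toEmbedding) : ℚ) : ℝ) := by
  unfold N2form N2C
  rw [sum_triple_codeE, cast_sum_arrSetC]
  refine sum_congr rfl fun τ _ => ?_
  simp only [arrInd_symm_codeE, setInd_symm_codeE, Equiv.apply_symm_apply]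
  split_ifs
  · push_cast; ring
  · simp

/-- ★ **From a passing coded certificate to 3C in all dimensions**: if the check passes for `(π, A, tab)` then
`c_{(π,b)}(frontFn 1_A, G, H) ≥ 0` for every back profile `b` on a cube of any dimension and all nonnegative monotone `G, H`. [this work] -/
theorem tc_frontFn_nonneg_of_certOKC (π : Fin k → ℕ) (A : Finset (Pt k)) (tab : Array ℚ)
    (h : certOKC (arrSetC π) (upSetsC k) (A.map (codeE k).toEmbedding) tab = true) {d : ℕ} (b : Fin d → ℕ) {G H : Pt (d + k) → ℝ}
    (hG : ∀ w, 0 ≤ G w) (hH : ∀ w, 0 ≤ H w) (hGm : Monotone G) (hHm : Monotone H) :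
    0 ≤ tc (appendProf k π b) (frontFn k (setInd A)) G H := by
  unfold certOKC at h
  rw [Bool.and_eq_true, decide_eq_true_eq, decide_eq_true_eq] at h
  obtain ⟨h0, h12⟩ := h
  refine tc_frontFn_nonneg_of_upSets k π (setInd A) (fun a _ _ => (thetaC tab (codeE k a) : ℝ)) (fun e₁ _ _ => ?_) ?_ ?_ b hG hH hGm hHm
  · exact_mod_cast h0 (codeE k e₁)
  · intro V W hV hW
    rw [N1form_eq_N1C]
    exact_mod_cast (h12 _ (map_mem_upSetsC hV) _ (map_mem_upSetsC hW)).1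
  · intro V W hV hW
    rw [N2form_eq_N2C]
    exact_mod_cast (h12 _ (map_mem_upSetsC hV) _ (map_mem_upSetsC hW)).2

/-- Profiles with an entry `≥ 4` have no arrangements: the coefficient vanishes. [this work] -/
theorem tc_frontFn_eq_zero_of_four_le (π : Fin k → ℕ) {i : Fin k} (hi : 4 ≤ π i) (f : Pt k → ℝ) {d : ℕ} (b : Fin d → ℕ)
    (G H : Pt (d + k) → ℝ) : tc (appendProf k π b) (frontFn k f) G H = 0 := by
  rw [tc_frontFn_eq]
  refine sum_eq_zero fun e₁ _ => sum_eq_zero fun e₂ _ => sum_eq_zero fun e₃ _ => ?_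
  have : ¬ IsArr π e₁ e₂ e₃ := by
    intro harr
    have h := harr i
    have h1 := Bool.toNat_le (e₁ i); have h2 := Bool.toNat_le (e₂ i); have h3 := Bool.toNat_le (e₃ i)
    omega
  rw [if_neg this]

end Bridge

/-! ### §3 ★★ 3C-SAHI for every triple whose first function depends on at most three (front) coordinates -/

/-- ★★ **THEOREM (one slot on three coordinates, the other two ARBITRARY).**  Let `A ⊆ {0,1}^3` be ANY up-set of the three front
coordinates (`∅, 1, x, xy, xyz, x∨y, x∨y∨z, x∨yz, x(y∨z), MAJ₃, …`: 20 of them), `π` ANY front profile, `b` ANY back profile on a cube of ANY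
dimension `d`, and `G, H` ANY nonnegative monotone functions on `{0,1}^{d+3}`.  Then `0 ≤ c_{(π,b)}(frontFn 1_A, G, H)`.  Proof: the
GENTOK certificate (`checkAll3_true`, by computation) + the two-point reduction theorem `tc_frontFn_nonneg_of_upSets`. [this work] -/
theorem tc_front3_nonneg (π : Fin 3 → ℕ) {A : Finset (Pt 3)} (hA : IsUpperSet (A : Set (Pt 3))) {d : ℕ} (b : Fin d → ℕ)
    {G H : Pt (d + 3) → ℝ} (hG : ∀ w, 0 ≤ G w) (hH : ∀ w, 0 ≤ H w) (hGm : Monotone G) (hHm : Monotone H) :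
    0 ≤ tc (appendProf 3 π b) (frontFn 3 (setInd A)) G H := by
  by_cases hπ : ∀ i, π i ≤ 3
  · let π' : Fin 3 → Fin 4 := fun i => ⟨π i, by have := hπ i; omega⟩
    have eπ : (fun i => ((π' i : Fin 4) : ℕ)) = π := funext fun _ => rfl
    have hc := certOKC_three π' (map_mem_upSetsC hA)
    rw [eπ] at hc
    exact tc_frontFn_nonneg_of_certOKC π A _ hc b hG hH hGm hHm
  · obtain ⟨i, hi⟩ := not_forall.mp hπ
    rw [tc_frontFn_eq_zero_of_four_le π (by omega : 4 ≤ π i)]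

/-- The same at an ARBITRARY profile `B` of the big cube `{0,1}^{d+3}` (every profile splits as `(π, b)`). [this work] -/
theorem tc_front3_nonneg_all {d : ℕ} (B : Fin (d + 3) → ℕ) {A : Finset (Pt 3)} (hA : IsUpperSet (A : Set (Pt 3)))
    {G H : Pt (d + 3) → ℝ} (hG : ∀ w, 0 ≤ G w) (hH : ∀ w, 0 ≤ H w) (hGm : Monotone G) (hHm : Monotone H) :
    0 ≤ tc B (frontFn 3 (setInd A)) G H := by
  obtain ⟨π, b, rfl⟩ := exists_appendProf 3 B
  exact tc_front3_nonneg π hA b hG hH hGm hHm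

/-- ★ **Law level (Kahn's inequality `E₃ ≥ 0` for this class).**  For every product measure on `{0,1}^{d+3}` (coin weights `q ∈ [0,1]^{d+3}`),
every up-set `A` of the three front coordinates and all nonnegative monotone `G, H`: `E₃^{coin q}(1_A∘front, G, H) ≥ 0`. [this work] -/
theorem sahiE_three_coin_front3_nonneg {d : ℕ} {q : Fin (d + 3) → ℝ} (hq : ∀ i, 0 ≤ q i ∧ q i ≤ 1) {A : Finset (Pt 3)}
    (hA : IsUpperSet (A : Set (Pt 3))) {G H : Pt (d + 3) → ℝ} (hG : ∀ w, 0 ≤ G w) (hH : ∀ w, 0 ≤ H w) (hGm : Monotone G)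
    (hHm : Monotone H) : 0 ≤ sahiE (coinWeight q) 3 ![frontFn 3 (setInd A), G, H] :=
  sahiE_three_coin_nonneg_of_tc hq fun B => tc_front3_nonneg_all B hA hG hH hGm hHm

end Summit.CriticalPhenomena.PercolationContinuityZ3.Theorems.SahiThreeCopy
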